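import Mathlib
import Literature.MathematicalPhysics.QuantumFieldTheory.WilsonFlow
import Literature.MathematicalPhysics.QuantumFieldTheory.Luscher2010.TrivializingMaps
import HarnessLib

/-!
HONEST FRAMING: exact (Metropolis-corrected) sampling algorithms for lattice gauge theory; figures
of merit are autocorrelation/cost numbers at stated couplings and volumes; no continuum-physics
claim.

# FlowLightCone — THEOREM L: a Lieb–Robinson-type light cone for continuous-time flows of strictly
local generators (THEORY-1.md §26; locality of flow-defined maps, volume-uniform)

Proposed tree path: `Summits/Ventures/LatticeQCDFlow/TrivializingMaps/FlowLightCone.lean` (OURS —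
venture-side, never `Literature/`). §1 is pure analysis (Mathlib only); §2 instantiates it for
Lüscher's flow lines `U̇_t = Z_t(U_t) U_t` on `SU(n)^E ⊆ M_n(ℂ)^E` (`IsFlowLine`, `IsFlowMap` of the
Literature typing `Luscher2010/TrivializingMaps.lean`).

SETTING. A finite index set `Λ` of "sites" (for us: the links of a periodic lattice), a real normed space
`W` of site values (for us: `M_n(ℂ)` with the Frobenius norm), and two curves `x y : ℝ → (Λ → W)` on a
time interval `[0, T]` with right derivatives `x' t`, `y' t` (for us: two flow lines `U̇ = Z_t(U) U` of
one generator, or of two generators). LOCALITY enters only through a family of READ SETS `N i ⊆ Λ` and a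
modulus `K ≥ 0`:

  `(MOD)  ‖x' t i - y' t i‖ ≤ K · M` whenever `‖x t j - y t j‖ ≤ M` for all `j ∈ N i` (`M ≥ 0`),

i.e. the velocity difference AT SITE `i` is controlled by the configuration difference ON THE READ SET of
`i` only (a strictly local, sup-Lipschitz generator). A LEVEL function `lvl : Λ → ℕ` with
`lvl i ≤ lvl j + 1` for `j ∈ N i` (any grading 1-Lipschitz for the read-set graph — e.g.
`lvl i = ⌊dist(i, D)/R⌋` for read sets of radius `R` and a set `D` of sites) such that the two initial
data AGREE at every site of level `≥ 1` and differ by at most `δ` everywhere.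

THEOREM L (`lightCone`). For all `t ∈ [0, T]` and every site `i`,

  `‖x t i - y t i‖ ≤ δ · e^{K t} · (K t)^{lvl i} / (lvl i)!`.

So the influence of a modification of the initial datum at read-set-graph distance `m` is suppressed by
`(Kt)^m/m! ≤ (eKt/m)^m`: super-exponentially small outside the "light cone" `m ≳ e K t`, with constants
depending only on `K` — NOT on `|Λ|` (volume-uniform whenever `K` is). Proof: induction on the level;
level `0` is Grönwall (`norm_le_gronwallBound_of_norm_deriv_right_le` on the sup-normed product), the
step is the fencing lemma `image_norm_le_of_norm_deriv_right_le_deriv_boundary` with barrier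
`B_{m+1}(s) = δ e^{Ks}(Ks)^{m+1}/(m+1)!`, `B'_{m+1} = K B_{m+1} + K B_m ≥ K B_m`. This is the classical
(Picard-iteration) mechanism behind finite-group-velocity / Lieb–Robinson bounds for lattice dynamics
[cf. Raz–Sims, J. Stat. Phys. 137 (2009) 79, eq. (1.3) and Thm. 1, and Marchioro–Pellegrinotti–Pulvirenti–
Triolo, J. Stat. Phys. 19 (1978) 499, cited there]; the present deterministic two-trajectory form for
first-order (non-Hamiltonian, e.g. gradient) flows with an explicit `(Kt)^m/m!` profile is ours.

COROLLARIES (§1): `lightCone_of_generator` (the modulus supplied by ONE time-dependent vector field `F`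
with read sets `N` and sup-Lipschitz constant `K`, two solutions), `lightCone_of_hasDerivAt` (globally
differentiable curves), `lightCone_level_mono` (uniform bound outside the cone of radius `m`, early
times), `lightCone_eq_of_K_zero` (degenerate case).

§2 LÜSCHER FLOWS (`IsFlowLine.lightCone`, `IsFlowMap.lightCone`): for two flow lines of generators
`Z, Z'` the modulus is asked of `Z_t(U)_e U_e - Z'_t(V)_e V_e`; for the FLOW MAP `Φ` of one generator `Z`
with read sets `N e ∋ e`, a sup-Lipschitz modulus `K_Z` and a sup bound `M_Z` of `Z_t(·)_e` on `SU(n)^E`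
(Frobenius norms), two initial fields `V, V'` agreeing at every link of level `≥ 1` give
`‖Φ_t(V)_e - Φ_t(V')_e‖_F ≤ 2n · e^{Kt}(Kt)^{lvl e}/(lvl e)!` with `K = n K_Z + M_Z` — a LIGHT CONE FOR
THE FLOW-DEFINED MAP with constants independent of the volume `L` whenever `K_Z, M_Z` are (Lüscher
§4.5(b): the truncated generator `-∂S̃^{[N]}_t` has read sets `linkBall (2(N+1)) e`, tree
`linkGrad_truncFlowAction_local`, and volume-uniform sup bounds by THEOREM A, tree `GeneratorLocality` §3).

WHAT THIS DOES NOT DO: it does not produce `K_Z` for Lüscher's truncated generator `-∂S̃^{[N]}_t`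
(a volume-uniform sup-Lipschitz modulus of `U ↦ ∂^a_e S̃^{(k)}(U)` on `SU(n)^E` — THEORY-1.md §26 names
it `TruncatedGeneratorLipschitz`, an open input: it needs a mixed second-derivative bound AND a
manifold mean-value inequality on `SU(n)`; the mixed bound is `GradedMixedDerivBounds.lean`), nor any
bound for the EXACT (untruncated) trivializing flow beyond the strong-coupling window.

RELATED IN THE TREE (no overlap of statements): `Scaling/LocalFlows.lean` (theory-2, T2-G: a composite
of finitely many coupling layers of footprint `r` is STRICTLY `N`-local, `IsLocalMap` — the discrete-time
light cone; a continuous-time flow is not strictly local at any `t > 0`, THEOREM L is its quantitative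
substitute); `Scaling/FlowLipschitzBudget.lean` (lean-1, `SUN.lipschitzWith_flowMap_one`: the GLOBAL,
level-`0` Grönwall statement — `Φ 1` is `e^K`-Lipschitz in the sup metric; THEOREM L refines it site
by site with the factor `(Kt)^{lvl}/lvl!`); `TrivializingMaps/GeneratorLocality.lean` (theory-1, C2:
locality of the GENERATOR series, not of the flow); `TrivializingMaps/TrivializingFlowLocality.lean`
(lean-2: locality properties of the strong-coupling map's generator).

References: H. Raz, R. Sims, J. Stat. Phys. 137 (2009) 79–108 [arXiv:0902.0025]; B. Nachtergaele,
H. Raz, B. Schlein, R. Sims, Comm. Math. Phys. 286 (2009) 1073 [arXiv:0712.3820]; M. Lüscher, Comm. Math.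
Phys. 293 (2010) 899–919, §3.2, §4.5(b) [key Luscher2010Trivializing]; THEORY-1.md §3, §26.
-/

open Set Real
open scoped Nat

namespace Summit.Ventures.LatticeQCDFlow.TrivializingMaps.LightCone

variable {Λ : Type*} [Fintype Λ] {W : Type*} [NormedAddCommGroup W] [NormedSpace ℝ W]

/-! ## The light-cone profile `B_m(s) = δ e^{Ks} (Ks)^m / m!` and its derivative -/

/-- `d/ds [δ e^{Ks}(Ks)^{m+1}/(m+1)!] = K·B_{m+1}(s) + K·B_m(s)`. [folklore] -/
theorem hasDerivAt_coneProfile_succ (δ K : ℝ) (m : ℕ) (s : ℝ) :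
    HasDerivAt (fun u : ℝ => δ * exp (K * u) * (K * u) ^ (m + 1) / ((m + 1)! : ℝ))
      (K * (δ * exp (K * s) * (K * s) ^ (m + 1) / ((m + 1)! : ℝ))
        + K * (δ * exp (K * s) * (K * s) ^ m / (m ! : ℝ))) s := by
  have h1 : HasDerivAt (fun u : ℝ => exp (K * u)) (exp (K * s) * K) s := by
    have h := ((hasDerivAt_id s).const_mul K).exp
    simpa only [id, mul_one] using h
  have h2 : HasDerivAt (fun u : ℝ => (K * u) ^ (m + 1))
      (((m + 1 : ℕ) : ℝ) * (K * s) ^ m * K) s := by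
    have h := (hasDerivAt_pow (m + 1) (K * s)).comp s ((hasDerivAt_id s).const_mul K)
    simpa only [Function.comp_def, id, mul_one, Nat.add_sub_cancel] using h
  have h3 := ((h1.const_mul δ).mul h2).div_const ((m + 1)! : ℝ)
  have h4 : HasDerivAt (fun u : ℝ => δ * exp (K * u) * (K * u) ^ (m + 1) / ((m + 1)! : ℝ))
      ((δ * (exp (K * s) * K) * (K * s) ^ (m + 1)
        + δ * exp (K * s) * (((m + 1 : ℕ) : ℝ) * (K * s) ^ m * K)) / ((m + 1)! : ℝ)) s := h3
  refine h4.congr_deriv ?_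
  have hm : (m ! : ℝ) ≠ 0 := by positivity
  rw [Nat.factorial_succ]
  push_cast
  field_simp

/-- The profile is nonnegative for `δ, K, s ≥ 0`. [folklore] -/
theorem coneProfile_nonneg {δ K s : ℝ} (hδ : 0 ≤ δ) (hK : 0 ≤ K) (hs : 0 ≤ s) (m : ℕ) :
    0 ≤ δ * exp (K * s) * (K * s) ^ m / (m ! : ℝ) := by
  positivity

/-! ## THEOREM L -/

/-- **THEOREM L (light cone for flows of strictly local generators).** Two curves `x, y : [0,T] → W^Λ`
with right derivatives `x', y'`; read sets `N i`; a level function with `lvl i ≤ lvl j + 1` for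
`j ∈ N i`; the local sup-Lipschitz modulus (MOD) with constant `K ≥ 0`; initial data `δ`-close
everywhere and EQUAL at every site of level `≥ 1`. Then
`‖x t i - y t i‖ ≤ δ e^{Kt} (Kt)^{lvl i}/(lvl i)!` on `[0, T]`. Constants independent of `|Λ|`.
[ours; cf. Raz–Sims 2009 (arXiv:0902.0025) eq. (1.3), Thm. 1] -/
theorem lightCone {x y x' y' : ℝ → Λ → W} {T K δ : ℝ} (hK : 0 ≤ K) (hδ : 0 ≤ δ)
    (N : Λ → Set Λ) (lvl : Λ → ℕ) (hlvl : ∀ i, ∀ j ∈ N i, lvl i ≤ lvl j + 1)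
    (hxc : ContinuousOn x (Icc 0 T)) (hyc : ContinuousOn y (Icc 0 T))
    (hx : ∀ t ∈ Ico 0 T, HasDerivWithinAt x (x' t) (Ici t) t)
    (hy : ∀ t ∈ Ico 0 T, HasDerivWithinAt y (y' t) (Ici t) t)
    (hmod : ∀ t ∈ Ico 0 T, ∀ (i : Λ) (M : ℝ), 0 ≤ M →
      (∀ j ∈ N i, ‖x t j - y t j‖ ≤ M) → ‖x' t i - y' t i‖ ≤ K * M)
    (h0 : ∀ j, ‖x 0 j - y 0 j‖ ≤ δ) (h0' : ∀ i, 1 ≤ lvl i → x 0 i = y 0 i) :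
    ∀ t ∈ Icc 0 T, ∀ i, ‖x t i - y t i‖ ≤ δ * exp (K * t) * (K * t) ^ (lvl i) / ((lvl i)! : ℝ) := by
  -- `P m`: every site of level `≥ m` obeys the level-`m` profile
  suffices P : ∀ m : ℕ, ∀ i, m ≤ lvl i → ∀ t ∈ Icc 0 T,
      ‖x t i - y t i‖ ≤ δ * exp (K * t) * (K * t) ^ m / (m ! : ℝ) from
    fun t ht i => P (lvl i) i le_rfl t ht
  intro m
  induction m with
  | zero =>
    -- Grönwall on the sup-normed product
    intro i _ t ht
    have hf' : ∀ s ∈ Ico 0 T, HasDerivWithinAt (fun s => x s - y s) (x' s - y' s) (Ici s) s :=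
      fun s hs => (hx s hs).sub (hy s hs)
    have ha : ‖x 0 - y 0‖ ≤ δ :=
      (pi_norm_le_iff_of_nonneg hδ).2 fun j => by simpa only [Pi.sub_apply] using h0 j
    have hbound : ∀ s ∈ Ico 0 T, ‖x' s - y' s‖ ≤ K * ‖x s - y s‖ + 0 := by
      intro s hs
      rw [add_zero]
      refine (pi_norm_le_iff_of_nonneg (by positivity)).2 fun i => ?_
      simpa only [Pi.sub_apply] using
        hmod s hs i ‖x s - y s‖ (norm_nonneg _)
          fun j _ => by simpa only [Pi.sub_apply] using norm_le_pi_norm (x s - y s) j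
    have hG := norm_le_gronwallBound_of_norm_deriv_right_le (hxc.sub hyc) hf' ha hbound t ht
    rw [gronwallBound_ε0, sub_zero] at hG
    have hi : ‖x t i - y t i‖ ≤ ‖x t - y t‖ := by
      simpa only [Pi.sub_apply] using norm_le_pi_norm (x t - y t) i
    simpa only [pow_zero, mul_one, Nat.factorial_zero, Nat.cast_one, div_one] using hi.trans hG
  | succ m ih =>
    intro i hi
    -- the site `i` has level `≥ m + 1 ≥ 1`: equal initial data, neighbours of level `≥ m`
    have hgc : ContinuousOn (fun s => x s i - y s i) (Icc 0 T) :=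
      ((continuous_apply i).comp_continuousOn hxc).sub ((continuous_apply i).comp_continuousOn hyc)
    have hg' : ∀ s ∈ Ico 0 T,
        HasDerivWithinAt (fun s => x s i - y s i) (x' s i - y' s i) (Ici s) s :=
      fun s hs => ((hasDerivWithinAt_pi.1 (hx s hs)) i).sub ((hasDerivWithinAt_pi.1 (hy s hs)) i)
    have hga : ‖x 0 i - y 0 i‖ ≤ δ * exp (K * 0) * (K * 0) ^ (m + 1) / ((m + 1)! : ℝ) := by
      rw [h0' i (le_trans (Nat.le_add_left 1 m) hi), sub_self, norm_zero]
      simp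
    have hB := fun s => hasDerivAt_coneProfile_succ δ K m s
    have hbound : ∀ s ∈ Ico 0 T, ‖x' s i - y' s i‖ ≤
        K * (δ * exp (K * s) * (K * s) ^ (m + 1) / ((m + 1)! : ℝ))
          + K * (δ * exp (K * s) * (K * s) ^ m / (m ! : ℝ)) := by
      intro s hs
      have hs0 : 0 ≤ s := hs.1
      have hN : ∀ j ∈ N i, ‖x s j - y s j‖ ≤ δ * exp (K * s) * (K * s) ^ m / (m ! : ℝ) :=
        fun j hj => ih j (by have := hlvl i j hj; omega) s (Ico_subset_Icc_self hs)
      have h := hmod s hs i _ (coneProfile_nonneg hδ hK hs0 m) hN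
      have hpos : 0 ≤ K * (δ * exp (K * s) * (K * s) ^ (m + 1) / ((m + 1)! : ℝ)) :=
        mul_nonneg hK (coneProfile_nonneg hδ hK hs0 (m + 1))
      linarith
    intro t ht
    exact image_norm_le_of_norm_deriv_right_le_deriv_boundary hgc hg' hga hB hbound ht

/-! ## Corollaries -/

/-- **THEOREM L for two solutions of ONE strictly local vector field.** `F t : W^Λ → W^Λ` with read sets
`N i` and sup-Lipschitz constant `K` on each read set; `x, y` two solutions (`ẋ = F_t(x)`) on `[0, T]`
whose initial data agree at every site of level `≥ 1` and are `δ`-close. Then the light-cone bound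
holds. [ours; cf. Raz–Sims 2009 (arXiv:0902.0025) Thm. 1] -/
theorem lightCone_of_generator (F : ℝ → (Λ → W) → Λ → W) {x y : ℝ → Λ → W} {T K δ : ℝ}
    (hK : 0 ≤ K) (hδ : 0 ≤ δ) (N : Λ → Set Λ) (lvl : Λ → ℕ)
    (hlvl : ∀ i, ∀ j ∈ N i, lvl i ≤ lvl j + 1)
    (hF : ∀ (t : ℝ) (u v : Λ → W) (i : Λ) (M : ℝ), 0 ≤ M →
      (∀ j ∈ N i, ‖u j - v j‖ ≤ M) → ‖F t u i - F t v i‖ ≤ K * M)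
    (hxc : ContinuousOn x (Icc 0 T)) (hyc : ContinuousOn y (Icc 0 T))
    (hx : ∀ t ∈ Ico 0 T, HasDerivWithinAt x (F t (x t)) (Ici t) t)
    (hy : ∀ t ∈ Ico 0 T, HasDerivWithinAt y (F t (y t)) (Ici t) t)
    (h0 : ∀ j, ‖x 0 j - y 0 j‖ ≤ δ) (h0' : ∀ i, 1 ≤ lvl i → x 0 i = y 0 i) :
    ∀ t ∈ Icc 0 T, ∀ i, ‖x t i - y t i‖ ≤ δ * exp (K * t) * (K * t) ^ (lvl i) / ((lvl i)! : ℝ) :=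
  lightCone (x' := fun t => F t (x t)) (y' := fun t => F t (y t)) hK hδ N lvl hlvl hxc hyc hx hy
    (fun t _ i M hM hN => hF t (x t) (y t) i M hM hN) h0 h0'

/-- **Globally defined curves** (derivatives everywhere, as for Lüscher's flow lines `IsFlowLine`): the
hypotheses of THEOREM L in `HasDerivAt` form. [ours] -/
theorem lightCone_of_hasDerivAt {x y x' y' : ℝ → Λ → W} {T K δ : ℝ} (hK : 0 ≤ K) (hδ : 0 ≤ δ)
    (N : Λ → Set Λ) (lvl : Λ → ℕ) (hlvl : ∀ i, ∀ j ∈ N i, lvl i ≤ lvl j + 1)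
    (hx : ∀ t, HasDerivAt x (x' t) t) (hy : ∀ t, HasDerivAt y (y' t) t)
    (hmod : ∀ t ∈ Ico 0 T, ∀ (i : Λ) (M : ℝ), 0 ≤ M →
      (∀ j ∈ N i, ‖x t j - y t j‖ ≤ M) → ‖x' t i - y' t i‖ ≤ K * M)
    (h0 : ∀ j, ‖x 0 j - y 0 j‖ ≤ δ) (h0' : ∀ i, 1 ≤ lvl i → x 0 i = y 0 i) :
    ∀ t ∈ Icc 0 T, ∀ i, ‖x t i - y t i‖ ≤ δ * exp (K * t) * (K * t) ^ (lvl i) / ((lvl i)! : ℝ) :=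
  lightCone hK hδ N lvl hlvl (fun t _ => (hx t).continuousAt.continuousWithinAt)
    (fun t _ => (hy t).continuousAt.continuousWithinAt) (fun t _ => (hx t).hasDerivWithinAt)
    (fun t _ => (hy t).hasDerivWithinAt) hmod h0 h0'

/-- **Uniform bound outside the cone of radius `m`, early times.** In the regime `K t ≤ 1` the profile
`(Kt)^l/l!` is non-increasing in the level `l`, so EVERY site of level `≥ m` obeys the level-`m` bound
`δ e^{Kt}(Kt)^m/m!` (for `K t > 1` use `lightCone` at the site's own level). [ours] -/
theorem lightCone_level_mono {x y x' y' : ℝ → Λ → W} {T K δ : ℝ} (hK : 0 ≤ K) (hδ : 0 ≤ δ)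
    (N : Λ → Set Λ) (lvl : Λ → ℕ) (hlvl : ∀ i, ∀ j ∈ N i, lvl i ≤ lvl j + 1)
    (hxc : ContinuousOn x (Icc 0 T)) (hyc : ContinuousOn y (Icc 0 T))
    (hx : ∀ t ∈ Ico 0 T, HasDerivWithinAt x (x' t) (Ici t) t)
    (hy : ∀ t ∈ Ico 0 T, HasDerivWithinAt y (y' t) (Ici t) t)
    (hmod : ∀ t ∈ Ico 0 T, ∀ (i : Λ) (M : ℝ), 0 ≤ M →
      (∀ j ∈ N i, ‖x t j - y t j‖ ≤ M) → ‖x' t i - y' t i‖ ≤ K * M)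
    (h0 : ∀ j, ‖x 0 j - y 0 j‖ ≤ δ) (h0' : ∀ i, 1 ≤ lvl i → x 0 i = y 0 i)
    {t : ℝ} (ht : t ∈ Icc 0 T) (hKt : K * t ≤ 1) (m : ℕ) (i : Λ) (hm : m ≤ lvl i) :
    ‖x t i - y t i‖ ≤ δ * exp (K * t) * (K * t) ^ m / (m ! : ℝ) := by
  have h := lightCone hK hδ N lvl hlvl hxc hyc hx hy hmod h0 h0' t ht i
  refine h.trans ?_
  have hKt0 : 0 ≤ K * t := mul_nonneg hK ht.1
  -- `(Kt)^l / l! ≤ (Kt)^m / m!` for `m ≤ l` when `Kt ≤ 1`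
  have hmono : (K * t) ^ (lvl i) / ((lvl i)! : ℝ) ≤ (K * t) ^ m / (m ! : ℝ) := by
    have hpow : (K * t) ^ (lvl i) ≤ (K * t) ^ m := pow_le_pow_of_le_one hKt0 hKt hm
    have hfac : (m ! : ℝ) ≤ ((lvl i)! : ℝ) := by exact_mod_cast Nat.factorial_le hm
    have hm0 : (0 : ℝ) < m ! := by positivity
    exact div_le_div₀ (pow_nonneg hKt0 _) hpow hm0 hfac
  have hc : 0 ≤ δ * exp (K * t) := by positivity
  calc δ * exp (K * t) * (K * t) ^ lvl i / ((lvl i)! : ℝ)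
      = δ * exp (K * t) * ((K * t) ^ lvl i / ((lvl i)! : ℝ)) := by ring
    _ ≤ δ * exp (K * t) * ((K * t) ^ m / (m ! : ℝ)) := mul_le_mul_of_nonneg_left hmono hc
    _ = δ * exp (K * t) * (K * t) ^ m / (m ! : ℝ) := by ring

/-- **Degenerate case `K = 0`** (a generator that does not depend on the configuration AT ALL through
the read sets — e.g. empty read sets): sites of level `≥ 1` never move apart, `x t i = y t i`.
Sanity/scope check of THEOREM L. [ours] -/
theorem lightCone_eq_of_K_zero {x y x' y' : ℝ → Λ → W} {T δ : ℝ} (hδ : 0 ≤ δ)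
    (N : Λ → Set Λ) (lvl : Λ → ℕ) (hlvl : ∀ i, ∀ j ∈ N i, lvl i ≤ lvl j + 1)
    (hxc : ContinuousOn x (Icc 0 T)) (hyc : ContinuousOn y (Icc 0 T))
    (hx : ∀ t ∈ Ico 0 T, HasDerivWithinAt x (x' t) (Ici t) t)
    (hy : ∀ t ∈ Ico 0 T, HasDerivWithinAt y (y' t) (Ici t) t)
    (hmod : ∀ t ∈ Ico 0 T, ∀ (i : Λ) (M : ℝ), 0 ≤ M →
      (∀ j ∈ N i, ‖x t j - y t j‖ ≤ M) → ‖x' t i - y' t i‖ ≤ 0 * M)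
    (h0 : ∀ j, ‖x 0 j - y 0 j‖ ≤ δ) (h0' : ∀ i, 1 ≤ lvl i → x 0 i = y 0 i)
    {t : ℝ} (ht : t ∈ Icc 0 T) (i : Λ) (hi : 1 ≤ lvl i) : x t i = y t i := by
  have h := lightCone le_rfl hδ N lvl hlvl hxc hyc hx hy hmod h0 h0' t ht i
  have hz : (0 * t) ^ (lvl i) = (0 : ℝ) := by
    rw [zero_mul]; exact zero_pow (by omega)
  rw [hz] at h
  exact sub_eq_zero.mp (norm_le_zero_iff.mp (by simpa using h))

end Summit.Ventures.LatticeQCDFlow.TrivializingMaps.LightCone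

/-! ## §2. Lüscher's flow lines and flow maps on `SU(n)^E` -/

namespace Summit.Ventures.LatticeQCDFlow.TrivializingMaps

open Literature.MathematicalPhysics.QuantumFieldTheory
open Literature.MathematicalPhysics.QuantumFieldTheory.Luscher2010
open Literature.MathematicalPhysics.QuantumFieldTheory.WilsonFlow (coeConfig)
open scoped Matrix Matrix.Norms.Frobenius

variable {d L n : ℕ} [NeZero L]

/-- The Frobenius norm of an `SU(n)` matrix is `≤ n` (every entry of a unitary matrix has modulus `≤ 1`;
in fact `= √n`). Volume plays no role. [folklore] -/
theorem frobenius_norm_coe_SU_le (U : Matrix.specialUnitaryGroup (Fin n) ℂ) :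
    ‖(U : Matrix (Fin n) (Fin n) ℂ)‖ ≤ n := by
  have hsq : ‖(U : Matrix (Fin n) (Fin n) ℂ)‖ ^ 2 ≤ (n : ℝ) ^ 2 := by
    rw [WilsonFlow.frobenius_norm_sq]
    have h1 : ∀ i j : Fin n, ‖(U : Matrix (Fin n) (Fin n) ℂ) i j‖ ^ 2 ≤ 1 := fun i j =>
      pow_le_one₀ (norm_nonneg _) (entry_norm_bound_of_unitary U.2.1 i j)
    calc ∑ i, ∑ j, ‖(U : Matrix (Fin n) (Fin n) ℂ) i j‖ ^ 2
        ≤ ∑ _i : Fin n, ∑ _j : Fin n, (1 : ℝ) :=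
          Finset.sum_le_sum fun i _ => Finset.sum_le_sum fun j _ => h1 i j
      _ = (n : ℝ) ^ 2 := by simp [sq]
  exact (pow_le_pow_iff_left₀ (norm_nonneg _) (Nat.cast_nonneg n) two_ne_zero).1 hsq

/-- **THEOREM L for Lüscher flow lines** (`U̇_t = Z_t(U_t) U_t`, `V̇_t = Z'_t(V_t) V_t`, eq. (3.2)): if the
velocity difference at link `e` is controlled by the field difference on the read set `N e`
(`‖Z_t(U)_e U_e - Z'_t(V)_e V_e‖ ≤ K · max_{e' ∈ N e} ‖U_{e'} - V_{e'}‖` along the two lines), and the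
initial fields are `δ`-close and EQUAL at links of level `≥ 1`, then
`‖U_t(e) - V_t(e)‖_F ≤ δ e^{Kt}(Kt)^{lvl e}/(lvl e)!` on `[0, T]`. [ours; cf. Luscher2010Trivializing §3.2,
Raz–Sims 2009 (arXiv:0902.0025) Thm. 1] -/
theorem IsFlowLine.lightCone {Z Z' : Generator d L n} {U V : ℝ → AmbConfig d L n}
    (hU : IsFlowLine Z U) (hV : IsFlowLine Z' V) {T K δ : ℝ} (hK : 0 ≤ K) (hδ : 0 ≤ δ)
    (N : Edge d L → Set (Edge d L)) (lvl : Edge d L → ℕ)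
    (hlvl : ∀ e, ∀ e' ∈ N e, lvl e ≤ lvl e' + 1)
    (hmod : ∀ t ∈ Set.Ico 0 T, ∀ (e : Edge d L) (M : ℝ), 0 ≤ M →
      (∀ e' ∈ N e, ‖U t e' - V t e'‖ ≤ M) → ‖Z t (U t) e * U t e - Z' t (V t) e * V t e‖ ≤ K * M)
    (h0 : ∀ e, ‖U 0 e - V 0 e‖ ≤ δ) (h0' : ∀ e, 1 ≤ lvl e → U 0 e = V 0 e) :
    ∀ t ∈ Set.Icc 0 T, ∀ e,
      ‖U t e - V t e‖ ≤ δ * Real.exp (K * t) * (K * t) ^ (lvl e) / ((lvl e)! : ℝ) :=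
  LightCone.lightCone_of_hasDerivAt (x' := fun t e => Z t (U t) e * U t e)
    (y' := fun t e => Z' t (V t) e * V t e) hK hδ N lvl hlvl
    (fun t => hasDerivAt_pi.2 fun e => WilsonFlow.hasDerivAt_of_entries fun i j => hU t e i j)
    (fun t => hasDerivAt_pi.2 fun e => WilsonFlow.hasDerivAt_of_entries fun i j => hV t e i j)
    hmod h0 h0'

/-- **LIGHT CONE FOR THE FLOW-DEFINED MAP.** Let `Φ` be the flow map of a generator `Z` on `SU(n)^E`
(`IsFlowMap Z Φ`) whose link-`e` component `Z_t(·)_e` (i) has a sup-Lipschitz modulus `K_Z` with respect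
to the links of a read set `N e ∋ e` and (ii) is bounded by `M_Z` in Frobenius norm, both on `SU(n)^E`
and for all `t`; let `lvl` be any level function with `lvl e ≤ lvl e' + 1` for `e' ∈ N e`. If two
initial fields `V, V'` agree at every link of level `≥ 1`, then for all `t ∈ [0, T]`
`‖Φ_t(V)_e - Φ_t(V')_e‖_F ≤ 2n · e^{Kt} (Kt)^{lvl e}/(lvl e)!`, `K = n K_Z + M_Z`: a modification of the
input field is felt at read-set-graph distance `m` only at order `(Kt)^m/m!`. Constants depend on
`n, K_Z, M_Z` only — on NEITHER `L` NOR `d` when `K_Z, M_Z` do not (network-size reading: a flow layer of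
time `t` built from a generator of footprint radius `R` is, up to `(Kt)^m/m!`, a map of receptive radius
`≈ R·eKt`). [ours; cf. Luscher2010Trivializing §3.2, §4.5(b)] -/
theorem IsFlowMap.lightCone {Z : Generator d L n}
    {Φ : ℝ → GaugeConfig d L (Matrix.specialUnitaryGroup (Fin n) ℂ) →
      GaugeConfig d L (Matrix.specialUnitaryGroup (Fin n) ℂ)}
    (hΦ : IsFlowMap Z Φ) (N : Edge d L → Set (Edge d L)) (hN : ∀ e, e ∈ N e) (lvl : Edge d L → ℕ)
    (hlvl : ∀ e, ∀ e' ∈ N e, lvl e ≤ lvl e' + 1) {KZ MZ : ℝ} (hKZ : 0 ≤ KZ) (hMZ : 0 ≤ MZ)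
    (hZlip : ∀ (t : ℝ) (U U' : GaugeConfig d L (Matrix.specialUnitaryGroup (Fin n) ℂ))
      (e : Edge d L) (M : ℝ), 0 ≤ M → (∀ e' ∈ N e, ‖coeConfig U e' - coeConfig U' e'‖ ≤ M) →
      ‖Z t (coeConfig U) e - Z t (coeConfig U') e‖ ≤ KZ * M)
    (hZbd : ∀ (t : ℝ) (U : GaugeConfig d L (Matrix.specialUnitaryGroup (Fin n) ℂ)) (e : Edge d L),
      ‖Z t (coeConfig U) e‖ ≤ MZ)
    (V V' : GaugeConfig d L (Matrix.specialUnitaryGroup (Fin n) ℂ))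
    (hVV' : ∀ e, 1 ≤ lvl e → V e = V' e) (T : ℝ) :
    ∀ t ∈ Set.Icc 0 T, ∀ e, ‖coeConfig (Φ t V) e - coeConfig (Φ t V') e‖ ≤
      2 * n * Real.exp ((n * KZ + MZ) * t) * ((n * KZ + MZ) * t) ^ (lvl e) / ((lvl e)! : ℝ) := by
  have hK : 0 ≤ (n : ℝ) * KZ + MZ := by positivity
  have hδ : (0 : ℝ) ≤ 2 * n := by positivity
  have hle : ∀ (U : GaugeConfig d L (Matrix.specialUnitaryGroup (Fin n) ℂ)) (e : Edge d L),
      ‖coeConfig U e‖ ≤ n := fun U e => by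
    rw [WilsonFlow.coeConfig_apply]; exact frobenius_norm_coe_SU_le (U e)
  refine IsFlowLine.lightCone (hΦ.2 V) (hΦ.2 V') hK hδ N lvl hlvl ?_ ?_ ?_
  · intro t _ e M hM hNe
    have h1 : ‖Z t (coeConfig (Φ t V)) e - Z t (coeConfig (Φ t V')) e‖ ≤ KZ * M :=
      hZlip t (Φ t V) (Φ t V') e M hM hNe
    have h2 : ‖Z t (coeConfig (Φ t V')) e‖ ≤ MZ := hZbd t (Φ t V') e
    have h3 : ‖coeConfig (Φ t V) e‖ ≤ n := hle (Φ t V) e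
    have h4 : ‖coeConfig (Φ t V) e - coeConfig (Φ t V') e‖ ≤ M := hNe e (hN e)
    have hsplit : Z t (coeConfig (Φ t V)) e * coeConfig (Φ t V) e
        - Z t (coeConfig (Φ t V')) e * coeConfig (Φ t V') e
        = (Z t (coeConfig (Φ t V)) e - Z t (coeConfig (Φ t V')) e) * coeConfig (Φ t V) e
          + Z t (coeConfig (Φ t V')) e * (coeConfig (Φ t V) e - coeConfig (Φ t V') e) := by
      rw [sub_mul, mul_sub]; abel
    rw [hsplit]
    calc ‖(Z t (coeConfig (Φ t V)) e - Z t (coeConfig (Φ t V')) e) * coeConfig (Φ t V) e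
          + Z t (coeConfig (Φ t V')) e * (coeConfig (Φ t V) e - coeConfig (Φ t V') e)‖
        ≤ ‖Z t (coeConfig (Φ t V)) e - Z t (coeConfig (Φ t V')) e‖ * ‖coeConfig (Φ t V) e‖
          + ‖Z t (coeConfig (Φ t V')) e‖ * ‖coeConfig (Φ t V) e - coeConfig (Φ t V') e‖ :=
          (norm_add_le _ _).trans (add_le_add (norm_mul_le _ _) (norm_mul_le _ _))
      _ ≤ KZ * M * n + MZ * M := by
          gcongr
      _ = (n * KZ + MZ) * M := by ring
  · intro e
    calc ‖coeConfig (Φ 0 V) e - coeConfig (Φ 0 V') e‖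
        ≤ ‖coeConfig (Φ 0 V) e‖ + ‖coeConfig (Φ 0 V') e‖ := norm_sub_le _ _
      _ ≤ n + n := add_le_add (hle _ e) (hle _ e)
      _ = 2 * n := by ring
  · intro e he
    rw [hΦ.1 V, hΦ.1 V', WilsonFlow.coeConfig_apply, WilsonFlow.coeConfig_apply, hVV' e he]

end Summit.Ventures.LatticeQCDFlow.TrivializingMaps
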